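import Literature.Analysis.ODE.BarrierTwoPoint
import Literature.Analysis.ODE.BarrierBasis
import Literature.Analysis.ODE.RecessiveRate
import Literature.Analysis.ODE.GrowthPairing
import HarnessLib

/-!
# Recessive dominance of a flux-carrying complex solution deep inside a barrier, and the resulting
# diagonal Green-kernel bound from growth rates

Topic `Literature/Analysis/ODE` (namespace `Literature.Analysis.ODE`). Setting: the REAL equation
`y″ = q(x) y` on a forbidden interval `[α, β]` (`q ≥ 0`), its two-end real basis `g` (`g(α) = 1`,
`g′(α) = 0`), `d` (`d(β) = 1`, `d′(β) = 0`) with Wronskian `g d′ − g′ d ≡ −w₀`, `w₀ = g′(β) > 0`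
(`BarrierBasis.exists_barrierBasis`), and a COMPLEX solution `v` known only through its data at the
RIGHT end `β` — a bound `‖v′(β)‖ ≤ P₁` and its conserved flux `Im(v̄ v′) ≡ F ≠ 0` (think: the
infinity-normalised solution of a radial wave equation, entering the barrier from the oscillatory far
side with flux `ω`). Over the basis, `v = a g + b d` with `a w₀ = v′(β)`; the flux identity
`F = −Im(ā b)·w₀` FLOORS `|b|` by `|F|/(|a| w₀)`, so the growing coefficient `a` is negligible against
the recessive one as soon as the barrier is deep:

* `re_conj_mul_deriv_le_of_right_flux` — if `4P₁² ≤ |F|·d(α)·w₀` (DEPTH: `d(α) w₀` is the product of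
  the two growth factors across `[α, β]`) and `r d(α) ≤ −d′(α)` (a certified recessive RATE at `α`,
  e.g. `RecessiveRate.tanh_mul_le_neg_deriv`), then at the left end
  `Re(v̄(α) v′(α)) ≤ −(7/25)·r·|v(α)|²`: `v` is inward-growing at (a fraction of) the recessive rate;
* `re_conj_mul_deriv_ge_of_left_flux` — the mirror statement for a solution `u` known through
  `‖u′(α)‖ ≤ P₁` and its flux at the LEFT end: `Re(ū(β) u′(β)) ≥ (7/25)·p·|u(β)|²` when
  `4P₁² ≤ |F|·g(β)·(−d′(α))` and `p g(β) ≤ g′(β)`;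
* `mul_cosh_le_of_sq_le_coeff_left` / `…_right` — CHAINABLE cosh growth in `HasDerivAt` form: on a
  sub-interval where `q ≥ k²`, `d(s) ≥ d(m)·cosh k(m − s)` to the left of any point `m` with
  `d′(m) ≤ 0` (resp. `g(s) ≥ g(m)·cosh k(s − m)` to the right of `m` with `g′(m) ≥ 0`) — the growth
  product `d(α) w₀` of the depth condition is certified piece by piece when `q` varies a lot;
* `re_conj_mul_deriv_le_of_right_flux_of_sq_le` — the packaged constant-rate case: `q` continuous,
  `q ≥ k² > 0` on `[α, β]`, `8P₁² ≤ k|F|·sinh(2k(β − α))` give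
  `Re(v̄(α) v′(α)) ≤ −(7/25)·k tanh(k(β − α))·|v(α)|²`;
* `kernel_le_of_recessive_dominated` — combined with the growth pairing (`GrowthPairing.lean`): if
  moreover `u` is outward-growing at `α` (`Re(ū u′)(α) ≥ 0`) with `|u(x)| ≤ |u(α)|`, then
  `(7/25)·r·|u(x)||v(α)| ≤ |W(α)|` — the two-point Green kernel deep inside a barrier is `O(1/rate)`.

This is the flux-free replacement, inside the barrier, of the flux pairing `|σ||v| ≤ |u||W|` that is
lost at the superradiant threshold (near-extremal Kerr programme, Carter's equation, BF-stable
sectors). Everything is one-interval real analysis plus one-point algebra; all proved.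

## References
* P. Hartman, *Ordinary Differential Equations* (SIAM Classics 38, 2002), Ch. XI §§2, 3, 6
  (Wronskian identities; Sturm comparison; principal/recessive solutions). Key `Hartman2002`.
* I. M. Gelfand, L. A. Dikii, Russian Math. Surveys 30:5 (1975) (diagonal resolvent kernel `ψ₊ψ₋/W`).
-/

noncomputable section

open Set
open scoped ComplexConjugate

namespace Literature.Analysis.ODE

/-! ### Chainable cosh growth in `HasDerivAt` form -/

/-- **Cosh growth to the left of a point where the solution is non-increasing.** Let `d″ = q d` on
`[s₀, m]` (pointwise `HasDerivAt` data), `q ≥ k²`, `d ≥ 0` there and `d′(m) ≤ 0`. Then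
`d(m)·cosh(k(m − s)) ≤ d(s)` for every `s ∈ [s₀, m]` (the Wronskian of `d` against `cosh k(s − m)` is
non-decreasing and `≤ 0` at `m`, so `d / cosh k(s − m)` is non-increasing).
[cite: Hartman2002, Ch. XI Thm. 3.2 and Ex. 3.1(a)] -/
theorem mul_cosh_le_of_sq_le_coeff_left {d d' q : ℝ → ℝ} {s₀ m k : ℝ}
    (hd : ∀ s ∈ Icc s₀ m, HasDerivAt d (d' s) s ∧ HasDerivAt d' (q s * d s) s)
    (hqk : ∀ s ∈ Icc s₀ m, k ^ 2 ≤ q s) (hd0 : ∀ s ∈ Icc s₀ m, 0 ≤ d s) (hdm : d' m ≤ 0) :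
    ∀ s ∈ Icc s₀ m, d m * Real.cosh (k * (m - s)) ≤ d s := by
  set C : ℝ → ℝ := fun s ↦ Real.cosh (k * (s - m)) with hC
  set C' : ℝ → ℝ := fun s ↦ k * Real.sinh (k * (s - m)) with hC'
  have hCd : ∀ s, HasDerivAt C (C' s) s :=
    fun s ↦ (((hasDerivAt_id' s).sub_const m).const_mul k).cosh.congr_deriv (by simp [hC']; ring)
  have hC'd : ∀ s, HasDerivAt C' (k ^ 2 * C s) s := fun s ↦
    ((((hasDerivAt_id' s).sub_const m).const_mul k).sinh.const_mul k).congr_deriv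
      (by simp [hC]; ring)
  have hCpos : ∀ s, 0 < C s := fun s ↦ Real.cosh_pos _
  -- the Wronskian `Ψ = d′ C − d C′` is non-decreasing and `Ψ(m) = d′(m) ≤ 0`
  set Ψ : ℝ → ℝ := fun s ↦ d' s * C s - d s * C' s with hΨ
  have hΨ' : ∀ s ∈ Icc s₀ m, HasDerivAt Ψ ((q s - k ^ 2) * d s * C s) s := by
    intro s hs
    have h := ((hd s hs).2.mul (hCd s)).sub ((hd s hs).1.mul (hC'd s))
    exact h.congr_deriv (by ring)
  have hmono : MonotoneOn Ψ (Icc s₀ m) :=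
    monotoneOn_of_deriv_nonneg (convex_Icc s₀ m)
      (fun s hs ↦ (hΨ' s hs).continuousAt.continuousWithinAt)
      (fun s hs ↦ (hΨ' s (interior_subset hs)).differentiableAt.differentiableWithinAt)
      fun s hs ↦ by
        have hs' : s ∈ Icc s₀ m := interior_subset hs
        rw [(hΨ' s hs').deriv]
        exact mul_nonneg (mul_nonneg (sub_nonneg.2 (hqk s hs')) (hd0 s hs')) (hCpos s).le
  have hΨm : Ψ m = d' m := by simp [hΨ, hC, hC']
  have hΨle : ∀ s ∈ Icc s₀ m, Ψ s ≤ 0 := fun s hs ↦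
    (hmono hs (right_mem_Icc.2 (hs.1.trans hs.2)) hs.2).trans (hΨm.le.trans hdm)
  -- hence `d / C` is non-increasing
  have hR : ∀ s ∈ Icc s₀ m, HasDerivAt (fun s ↦ d s / C s) (Ψ s / C s ^ 2) s := fun s hs ↦
    ((hd s hs).1.div (hCd s) (hCpos s).ne').congr_deriv (by simp [hΨ])
  have hanti : AntitoneOn (fun s ↦ d s / C s) (Icc s₀ m) :=
    antitoneOn_of_deriv_nonpos (convex_Icc s₀ m)
      (fun s hs ↦ (hR s hs).continuousAt.continuousWithinAt)
      (fun s hs ↦ (hR s (interior_subset hs)).differentiableAt.differentiableWithinAt)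
      fun s hs ↦ by
        have hs' : s ∈ Icc s₀ m := interior_subset hs
        rw [(hR s hs').deriv]
        exact div_nonpos_of_nonpos_of_nonneg (hΨle s hs') (sq_nonneg _)
  intro s hs
  have hm : m ∈ Icc s₀ m := right_mem_Icc.2 (hs.1.trans hs.2)
  have h := hanti hs hm hs.2
  simp only at h
  have hCm : C m = 1 := by simp [hC]
  rw [hCm, div_one, le_div_iff₀ (hCpos s)] at h
  have e : C s = Real.cosh (k * (m - s)) := by
    simp only [hC]; rw [← Real.cosh_neg]; ring_nf
  rw [← e]; exact h

/-- **Cosh growth to the right of a point where the solution is non-decreasing.** Let `g″ = q g` on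
`[m, s₁]`, `q ≥ k²`, `g ≥ 0` there and `g′(m) ≥ 0`. Then `g(m)·cosh(k(s − m)) ≤ g(s)` for every
`s ∈ [m, s₁]`. [cite: Hartman2002, Ch. XI Thm. 3.2 and Ex. 3.1(a)] -/
theorem mul_cosh_le_of_sq_le_coeff_right {g g' q : ℝ → ℝ} {m s₁ k : ℝ}
    (hg : ∀ s ∈ Icc m s₁, HasDerivAt g (g' s) s ∧ HasDerivAt g' (q s * g s) s)
    (hqk : ∀ s ∈ Icc m s₁, k ^ 2 ≤ q s) (hg0 : ∀ s ∈ Icc m s₁, 0 ≤ g s) (hgm : 0 ≤ g' m) :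
    ∀ s ∈ Icc m s₁, g m * Real.cosh (k * (s - m)) ≤ g s := by
  set C : ℝ → ℝ := fun s ↦ Real.cosh (k * (s - m)) with hC
  set C' : ℝ → ℝ := fun s ↦ k * Real.sinh (k * (s - m)) with hC'
  have hCd : ∀ s, HasDerivAt C (C' s) s :=
    fun s ↦ (((hasDerivAt_id' s).sub_const m).const_mul k).cosh.congr_deriv (by simp [hC']; ring)
  have hC'd : ∀ s, HasDerivAt C' (k ^ 2 * C s) s := fun s ↦
    ((((hasDerivAt_id' s).sub_const m).const_mul k).sinh.const_mul k).congr_deriv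
      (by simp [hC]; ring)
  have hCpos : ∀ s, 0 < C s := fun s ↦ Real.cosh_pos _
  set Ψ : ℝ → ℝ := fun s ↦ g' s * C s - g s * C' s with hΨ
  have hΨ' : ∀ s ∈ Icc m s₁, HasDerivAt Ψ ((q s - k ^ 2) * g s * C s) s := by
    intro s hs
    have h := ((hg s hs).2.mul (hCd s)).sub ((hg s hs).1.mul (hC'd s))
    exact h.congr_deriv (by ring)
  have hmono : MonotoneOn Ψ (Icc m s₁) :=
    monotoneOn_of_deriv_nonneg (convex_Icc m s₁)
      (fun s hs ↦ (hΨ' s hs).continuousAt.continuousWithinAt)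
      (fun s hs ↦ (hΨ' s (interior_subset hs)).differentiableAt.differentiableWithinAt)
      fun s hs ↦ by
        have hs' : s ∈ Icc m s₁ := interior_subset hs
        rw [(hΨ' s hs').deriv]
        exact mul_nonneg (mul_nonneg (sub_nonneg.2 (hqk s hs')) (hg0 s hs')) (hCpos s).le
  have hΨm : Ψ m = g' m := by simp [hΨ, hC, hC']
  have hΨge : ∀ s ∈ Icc m s₁, 0 ≤ Ψ s := fun s hs ↦
    (hgm.trans hΨm.ge).trans (hmono (left_mem_Icc.2 (hs.1.trans hs.2)) hs hs.1)
  have hR : ∀ s ∈ Icc m s₁, HasDerivAt (fun s ↦ g s / C s) (Ψ s / C s ^ 2) s := fun s hs ↦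
    ((hg s hs).1.div (hCd s) (hCpos s).ne').congr_deriv (by simp [hΨ])
  have hmono' : MonotoneOn (fun s ↦ g s / C s) (Icc m s₁) :=
    monotoneOn_of_deriv_nonneg (convex_Icc m s₁)
      (fun s hs ↦ (hR s hs).continuousAt.continuousWithinAt)
      (fun s hs ↦ (hR s (interior_subset hs)).differentiableAt.differentiableWithinAt)
      fun s hs ↦ by
        have hs' : s ∈ Icc m s₁ := interior_subset hs
        rw [(hR s hs').deriv]
        exact div_nonneg (hΨge s hs') (sq_nonneg _)
  intro s hs
  have hm : m ∈ Icc m s₁ := left_mem_Icc.2 (hs.1.trans hs.2)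
  have h := hmono' hm hs hs.1
  simp only at h
  have hCm : C m = 1 := by simp [hC]
  rw [hCm, div_one, le_div_iff₀ (hCpos s)] at h
  exact h

/-! ### Recessive dominance from the flux at the right end -/

/-- **A flux-carrying solution is recessive-dominated deep inside a barrier.** On `[α, β]` let `g, d`
be real solutions of `y″ = q y` with `g(α) = 1`, `g′(α) = 0`, `d(β) = 1`, `d′(β) = 0`,
`g′(β) = w₀ > 0`, `g d′ − g′ d ≡ −w₀`, `d(α) ≥ 0`, and let `v` be a complex solution with
`‖v′(β)‖ ≤ P₁` and flux `Im(v̄(β) v′(β)) = F`. If the barrier is DEEP, `4P₁² ≤ |F|·d(α)·w₀` (void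
unless `F ≠ 0`), and
`d` decays at `α` at rate at least `r ≥ 0`, `r d(α) ≤ −d′(α)`, then
`Re(v̄(α) v′(α)) ≤ −(7/25)·r·|v(α)|²`. Proof: `v = a g + b d` with `a w₀ = v′(β)`
(`eq_mul_add_of_right_data`), `|F| ≤ |a||b| w₀` (`flux_of_combination`), hence `|a| ≤ ¼|b| d(α)`;
then `re_conj_mul_le_of_recessive_dominated` at `α` (`g′(α) = 0`). [folklore] -/
theorem re_conj_mul_deriv_le_of_right_flux {q g g' d d' : ℝ → ℝ} {v v' : ℝ → ℂ}
    {α β w₀ r F P₁ : ℝ} (hαβ : α ≤ β) (hw₀ : 0 < w₀)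
    (hg : ∀ x ∈ Icc α β, HasDerivAt g (g' x) x ∧ HasDerivAt g' (q x * g x) x)
    (hd : ∀ x ∈ Icc α β, HasDerivAt d (d' x) x ∧ HasDerivAt d' (q x * d x) x)
    (hgα : g α = 1) (hg'α : g' α = 0) (hdβ : d β = 1) (hd'β : d' β = 0) (hg'β : g' β = w₀)
    (hW : ∀ x ∈ Icc α β, g x * d' x - g' x * d x = -w₀) (hdα : 0 ≤ d α)
    (hv : ∀ x ∈ Icc α β, HasDerivAt v (v' x) x ∧ HasDerivAt v' ((q x : ℂ) * v x) x)
    (hF : (conj (v β) * v' β).im = F) (hP₁ : ‖v' β‖ ≤ P₁)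
    (hr : 0 ≤ r) (hrate : r * d α ≤ -d' α) (hdeep : 4 * P₁ ^ 2 ≤ |F| * (d α * w₀)) :
    (conj (v α) * v' α).re ≤ -(7 / 25 * r) * ‖v α‖ ^ 2 := by
  have hα : α ∈ Icc α β := left_mem_Icc.2 hαβ
  have hβ : β ∈ Icc α β := right_mem_Icc.2 hαβ
  have hwC : (w₀ : ℂ) ≠ 0 := Complex.ofReal_ne_zero.2 hw₀.ne'
  -- coefficients from the right data
  set a : ℂ := v' β / w₀ with ha
  set b : ℂ := v β - a * g β with hb
  have ha' : a * w₀ = v' β := by rw [ha]; exact div_mul_cancel₀ _ hwC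
  have hb' : a * g β + b = v β := by rw [hb]; ring
  have hrep : ∀ x ∈ Icc α β, v x = a * g x + b * d x ∧ v' x = a * g' x + b * d' x :=
    fun x hx ↦ eq_mul_add_of_right_data hv hg hd hdβ hd'β hg'β hw₀.ne' hW ha' hb' hx
  -- the flux at `β`: `F = -Im(ā b) w₀`, so `|F| ≤ |a||b| w₀`
  have hflux : |F| ≤ ‖a‖ * ‖b‖ * w₀ := by
    have h := abs_flux_combination_le a b (g β) (g' β) (d β) (d' β)
    rw [← (hrep β hβ).1, ← (hrep β hβ).2, hF, hdβ, hd'β, hg'β, mul_zero, one_mul, zero_sub,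
      abs_neg, abs_of_pos hw₀] at h
    exact h
  -- `d′(α) = −w₀` and `−d′(α) ≥ 0`
  have hd'α : d' α = -w₀ := by
    have h := hW α hα; rw [hgα, hg'α, one_mul, zero_mul, sub_zero] at h; exact h
  have hnd : 0 ≤ -d' α := by rw [hd'α, neg_neg]; exact hw₀.le
  -- dominance `‖a‖ ≤ ¼ ‖b‖ d(α)`
  have ha2 : ‖a‖ ^ 2 * w₀ ≤ P₁ ^ 2 / w₀ := by
    rw [ha, norm_div, Complex.norm_of_nonneg hw₀.le, div_pow, le_div_iff₀ hw₀]
    have : ‖v' β‖ ^ 2 ≤ P₁ ^ 2 := pow_le_pow_left₀ (norm_nonneg _) hP₁ 2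
    calc ‖v' β‖ ^ 2 / w₀ ^ 2 * w₀ * w₀ = ‖v' β‖ ^ 2 := by field_simp
      _ ≤ P₁ ^ 2 := this
  have hdom : ‖a‖ * g α ≤ 1 / 4 * (‖b‖ * d α) := by
    rw [hgα, mul_one]
    -- `‖a‖² w₀ ≤ P₁²/w₀ ≤ ¼ |F| d(α) ≤ ¼ ‖a‖‖b‖ w₀ d(α)`
    have h1 : ‖a‖ ^ 2 * w₀ ≤ 1 / 4 * (‖a‖ * ‖b‖ * w₀) * d α := by
      have e1 : P₁ ^ 2 / w₀ ≤ 1 / 4 * |F| * d α := by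
        rw [div_le_iff₀ hw₀]; linarith
      have e2 : 1 / 4 * |F| * d α ≤ 1 / 4 * (‖a‖ * ‖b‖ * w₀) * d α :=
        mul_le_mul_of_nonneg_right (mul_le_mul_of_nonneg_left hflux (by norm_num)) hdα
      exact ha2.trans (e1.trans e2)
    rcases (norm_nonneg a).eq_or_lt with h0 | hpos
    · rw [← h0]; positivity
    · have h2 : ‖a‖ * (‖a‖ * w₀) ≤ 1 / 4 * (‖b‖ * d α) * (‖a‖ * w₀) := by nlinarith
      exact le_of_mul_le_mul_right h2 (mul_pos hpos hw₀)
  have hdom' : ‖a‖ * g' α ≤ 1 / 4 * (‖b‖ * -d' α) := by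
    rw [hg'α, mul_zero]; positivity
  -- the one-point algebra at `α`
  have key := re_conj_mul_le_of_recessive_dominated (a := a) (b := b) (g := g α) (g' := g' α)
    (d := d α) (d' := d' α) (ε := 1 / 4) (r := r) (by rw [hgα]; exact zero_le_one)
    (by rw [hg'α]) hdα (by linarith) (by norm_num) (by norm_num) hr hdom hdom' hrate
  rw [← (hrep α hα).1, ← (hrep α hα).2] at key
  have e : -((1 - 2 * (1 / 4 : ℝ) - (1 / 4) ^ 2) / (1 + 1 / 4) ^ 2) * r = -(7 / 25 * r) := by norm_num
  rw [e] at key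
  exact key

/-- **A flux-carrying solution is growing-dominated at the far end of a deep barrier** (mirror of
`re_conj_mul_deriv_le_of_right_flux`). On `[α, β]` let `g, d` be as there with moreover `g(β) ≥ 0`,
`g′(β) = w₀ > 0` written also as `d′(α) = −w₀`, and let `u` be a complex solution with
`‖u′(α)‖ ≤ P₁` and flux `Im(ū(α) u′(α)) = F`. If `4P₁² ≤ |F|·g(β)·w₀` and `p g(β) ≤ g′(β)` with
`p ≥ 0`, then `Re(ū(β) u′(β)) ≥ (7/25)·p·|u(β)|²`. [folklore] -/
theorem re_conj_mul_deriv_ge_of_left_flux {q g g' d d' : ℝ → ℝ} {u u' : ℝ → ℂ}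
    {α β w₀ p F P₁ : ℝ} (hαβ : α ≤ β) (hw₀ : 0 < w₀)
    (hg : ∀ x ∈ Icc α β, HasDerivAt g (g' x) x ∧ HasDerivAt g' (q x * g x) x)
    (hd : ∀ x ∈ Icc α β, HasDerivAt d (d' x) x ∧ HasDerivAt d' (q x * d x) x)
    (hgα : g α = 1) (hg'α : g' α = 0) (hdβ : d β = 1) (hd'β : d' β = 0) (hg'β : g' β = w₀)
    (hW : ∀ x ∈ Icc α β, g x * d' x - g' x * d x = -w₀) (hgβ : 0 ≤ g β)
    (hu : ∀ x ∈ Icc α β, HasDerivAt u (u' x) x ∧ HasDerivAt u' ((q x : ℂ) * u x) x)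
    (hF : (conj (u α) * u' α).im = F) (hP₁ : ‖u' α‖ ≤ P₁)
    (hp : 0 ≤ p) (hrate : p * g β ≤ g' β) (hdeep : 4 * P₁ ^ 2 ≤ |F| * (g β * w₀)) :
    7 / 25 * p * ‖u β‖ ^ 2 ≤ (conj (u β) * u' β).re := by
  have hα : α ∈ Icc α β := left_mem_Icc.2 hαβ
  have hβ : β ∈ Icc α β := right_mem_Icc.2 hαβ
  have hwC : (w₀ : ℂ) ≠ 0 := Complex.ofReal_ne_zero.2 hw₀.ne'
  have hd'α : d' α = -w₀ := by
    have h := hW α hα; rw [hgα, hg'α, one_mul, zero_mul, sub_zero] at h; exact h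
  -- coefficients from the left data
  set b : ℂ := -u' α / w₀ with hb
  set a : ℂ := u α - b * d α with ha
  have hb' : b * w₀ = -u' α := by rw [hb]; exact div_mul_cancel₀ _ hwC
  have ha' : a + b * d α = u α := by rw [ha]; ring
  have hrep : ∀ x ∈ Icc α β, u x = a * g x + b * d x ∧ u' x = a * g' x + b * d' x :=
    fun x hx ↦ eq_mul_add_of_left_data hu hg hd hgα hg'α hw₀.ne' hW hb' ha' hx
  -- the flux at `α`: `|F| ≤ |a||b| w₀`
  have hflux : |F| ≤ ‖a‖ * ‖b‖ * w₀ := by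
    have h := abs_flux_combination_le a b (g α) (g' α) (d α) (d' α)
    rw [← (hrep α hα).1, ← (hrep α hα).2, hF, hgα, hg'α, hd'α, one_mul, mul_zero, sub_zero,
      abs_neg, abs_of_pos hw₀] at h
    exact h
  -- dominance `‖b‖ ≤ ¼ ‖a‖ g(β)`
  have hb2 : ‖b‖ ^ 2 * w₀ ≤ P₁ ^ 2 / w₀ := by
    rw [hb, norm_div, norm_neg, Complex.norm_of_nonneg hw₀.le, div_pow, le_div_iff₀ hw₀]
    have : ‖u' α‖ ^ 2 ≤ P₁ ^ 2 := pow_le_pow_left₀ (norm_nonneg _) hP₁ 2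
    calc ‖u' α‖ ^ 2 / w₀ ^ 2 * w₀ * w₀ = ‖u' α‖ ^ 2 := by field_simp
      _ ≤ P₁ ^ 2 := this
  have hdom : ‖b‖ * d β ≤ 1 / 4 * (‖a‖ * g β) := by
    rw [hdβ, mul_one]
    have h1 : ‖b‖ ^ 2 * w₀ ≤ 1 / 4 * (‖a‖ * ‖b‖ * w₀) * g β := by
      have e1 : P₁ ^ 2 / w₀ ≤ 1 / 4 * |F| * g β := by
        rw [div_le_iff₀ hw₀]; linarith
      have e2 : 1 / 4 * |F| * g β ≤ 1 / 4 * (‖a‖ * ‖b‖ * w₀) * g β :=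
        mul_le_mul_of_nonneg_right (mul_le_mul_of_nonneg_left hflux (by norm_num)) hgβ
      exact hb2.trans (e1.trans e2)
    rcases (norm_nonneg b).eq_or_lt with h0 | hpos
    · rw [← h0]; positivity
    · have h2 : ‖b‖ * (‖b‖ * w₀) ≤ 1 / 4 * (‖a‖ * g β) * (‖b‖ * w₀) := by nlinarith
      exact le_of_mul_le_mul_right h2 (mul_pos hpos hw₀)
  have hdom' : ‖b‖ * -d' β ≤ 1 / 4 * (‖a‖ * g' β) := by
    rw [hd'β, neg_zero, mul_zero, hg'β]; positivity
  have hg'β0 : 0 ≤ g' β := by rw [hg'β]; exact hw₀.le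
  have key := re_conj_mul_ge_of_growing_dominated (a := a) (b := b) (g := g β) (g' := g' β)
    (d := d β) (d' := d' β) (ε := 1 / 4) (p := p) hgβ hg'β0 (by rw [hdβ]; exact zero_le_one)
    (by rw [hd'β]) (by norm_num) (by norm_num) hp hdom hdom' hrate
  rw [← (hrep β hβ).1, ← (hrep β hβ).2] at key
  have e : (1 - 2 * (1 / 4 : ℝ) - (1 / 4) ^ 2) / (1 + 1 / 4) ^ 2 * p = 7 / 25 * p := by norm_num
  rw [e] at key
  exact key

/-! ### The packaged constant-rate case and the kernel bound -/

/-- **Recessive dominance, constant-rate form.** Let `q` be continuous with `q ≥ k²` on `[α, β]`,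
`α < β`, `k > 0`, and let `v` be a complex solution of `y″ = q y` on `[α, β]` with `‖v′(β)‖ ≤ P₁` and
flux `Im(v̄(β) v′(β)) = F`. If `8P₁² ≤ k|F|·sinh(2k(β − α))`, then
`Re(v̄(α) v′(α)) ≤ −(7/25)·k tanh(k(β − α))·|v(α)|²` (barrier basis of `exists_barrierBasis`;
depth `d(α) w₀ ≥ cosh·k sinh = (k/2) sinh(2k(β − α))`; rate `k tanh(k(β − α))` by
`tanh_mul_le_neg_deriv`). [folklore] -/
theorem re_conj_mul_deriv_le_of_right_flux_of_sq_le {q : ℝ → ℝ} (hq : Continuous q) {α β k : ℝ}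
    (hαβ : α < β) (hk : 0 < k) (hqk : ∀ x ∈ Icc α β, k ^ 2 ≤ q x) {v v' : ℝ → ℂ}
    (hv : ∀ x ∈ Icc α β, HasDerivAt v (v' x) x ∧ HasDerivAt v' ((q x : ℂ) * v x) x)
    {F P₁ : ℝ} (hF : (conj (v β) * v' β).im = F) (hP₁ : ‖v' β‖ ≤ P₁)
    (hdeep : 8 * P₁ ^ 2 ≤ k * |F| * Real.sinh (2 * (k * (β - α)))) :
    (conj (v α) * v' α).re ≤ -(7 / 25 * (k * Real.tanh (k * (β - α)))) * ‖v α‖ ^ 2 := by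
  have hq0 : ∀ x ∈ Icc α β, 0 ≤ q x := fun x hx ↦ (sq_nonneg k).trans (hqk x hx)
  obtain ⟨g, g', d, d', hg, hd, hgα, hg'α, hdβ, hd'β, hsign, -, -, hW, hd'α, hcosh⟩ :=
    exists_barrierBasis hq hαβ.le hq0
  have hα : α ∈ Icc α β := left_mem_Icc.2 hαβ.le
  have hβ : β ∈ Icc α β := right_mem_Icc.2 hαβ.le
  set w₀ := g' β with hw₀def
  set ℓ := β - α with hℓ
  have hℓ0 : 0 < ℓ := sub_pos.2 hαβ
  have hkℓ : 0 < k * ℓ := mul_pos hk hℓ0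
  -- growth and rate at `α`
  obtain ⟨-, -, hdcosh, hdsinh⟩ := hcosh k hk hqk α hα
  have hw₀ : 0 < w₀ := by
    have h := (hcosh k hk hqk β hβ).2.1
    have : 0 < k * Real.sinh (k * (β - α)) := mul_pos hk (Real.sinh_pos_iff.2 hkℓ)
    exact this.trans_le h
  have hdα1 : 1 ≤ d α := (hsign α hα).2.2.1
  have hrate : k * Real.tanh (k * ℓ) * d α ≤ -d' α :=
    tanh_mul_le_neg_deriv (fun s hs ↦ hd s) hqk (fun s hs ↦ by linarith [(hsign s hs).2.2.1])
      (hd'β.le) α hα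
  have hr0 : 0 ≤ k * Real.tanh (k * ℓ) := by
    rw [Real.tanh_eq_sinh_div_cosh]
    exact mul_nonneg hk.le (div_nonneg (Real.sinh_nonneg_iff.2 hkℓ.le) (Real.cosh_pos _).le)
  -- depth: `d(α) w₀ ≥ cosh(kℓ) · k sinh(kℓ) = (k/2) sinh(2kℓ)`
  have hdepth : 4 * P₁ ^ 2 ≤ |F| * (d α * w₀) := by
    have h1 : Real.cosh (k * ℓ) * (k * Real.sinh (k * ℓ)) ≤ d α * w₀ := by
      have e : w₀ = -d' α := by rw [hd'α]; ring
      rw [e]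
      exact mul_le_mul hdcosh hdsinh (mul_nonneg hk.le (Real.sinh_nonneg_iff.2 hkℓ.le))
        (by linarith)
    have h2 : Real.cosh (k * ℓ) * (k * Real.sinh (k * ℓ)) = k / 2 * Real.sinh (2 * (k * ℓ)) := by
      rw [Real.sinh_two_mul]; ring
    rw [h2] at h1
    have h3 : |F| * (k / 2 * Real.sinh (2 * (k * ℓ))) ≤ |F| * (d α * w₀) :=
      mul_le_mul_of_nonneg_left h1 (abs_nonneg F)
    nlinarith [h3, hdeep, abs_nonneg F]
  have hWg : ∀ x ∈ Icc α β, g x * d' x - g' x * d x = -w₀ := fun x hx ↦ by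
    have := hW x hx; rw [hw₀def]; linarith [this]
  exact re_conj_mul_deriv_le_of_right_flux hαβ.le hw₀ (fun x hx ↦ hg x) (fun x hx ↦ hd x) hgα hg'α
    hdβ hd'β rfl hWg (by linarith) hv hF hP₁ hr0 hrate hdepth

/-- **Two-point Green kernel deep inside a barrier.** If at the point `α` the solution `v` is
inward-growing at rate `(7/25) r` in the sense `Re(v̄ v′)(α) ≤ −(7/25)·r·|v(α)|²` (e.g. by
`re_conj_mul_deriv_le_of_right_flux`), while `u` is outward-growing there, `Re(ū u′)(α) ≥ 0`, with
`|u(x)| ≤ |u(α)|` (e.g. `u` non-decreasing in modulus to the left of `α`), then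
`(7/25)·r·|u(x)|·|v(α)| ≤ |u(α) v′(α) − v(α) u′(α)|` (`two_point_le_norm_wronskian_of_growth`).
[folklore] -/
theorem kernel_le_of_recessive_dominated {u u' v v' : ℝ → ℂ} {x α r : ℝ} (hr : 0 ≤ r)
    (hmono : ‖u x‖ ≤ ‖u α‖) (hu : 0 ≤ (conj (u α) * u' α).re)
    (hv : (conj (v α) * v' α).re ≤ -(7 / 25 * r) * ‖v α‖ ^ 2) :
    7 / 25 * r * (‖u x‖ * ‖v α‖) ≤ ‖u α * v' α - v α * u' α‖ :=
  two_point_le_norm_wronskian_of_growth (by positivity) hmono hu hv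

end Literature.Analysis.ODE

end
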